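import Summits.Langlands.Langlands.Theses.PotentialCompanionDescent
import Summits.Langlands.Langlands.Theorems.PotentialCompanionDescentBrauerTaylorDescentDescentData
import Summits.Langlands.Langlands.Theorems.PotentialCompanionDescentBrauerTaylorDescentCompanionRigidity
import Summits.Langlands.Langlands.Theorems.PotentialCompanionDescentBrauerTaylorDescentSinglePairing
import Summits.Langlands.Langlands.Theorems.PotentialCompanionDescentBrauerTaylorDescentRestriction
import Summits.Langlands.Langlands.Theorems.PotentialCompanionDescentBrauerTaylorDescentFraming
import Literature.NumberTheory.GaloisRepresentations.FramedGaloisRepSemisimplification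
import Literature.NumberTheory.GaloisRepresentations.FramedGaloisRepInduce
import Literature.NumberTheory.GaloisRepresentations.IntegralGaloisActionProofs
import HarnessLib

/-!
# Brauer–Taylor descent: proof of `PotentialCompanionDescent.BrauerTaylorDescent`

The assembly of the lineage programme (Barnet-Lamb–Gee–Geraghty–Taylor, Ann. of Math. 179
(2014), proof of Thm. 5.5.1 = arXiv:1010.2561 Thm. 5.4.1; Taylor 2006, proof of Thm. 6.6):
given the `ℓ`-adic `ρ` over `K`, companions `ρ₂^{(M)}` of `ρ|_M` over every intermediate field
`K ⊆ M ⊆ L` with `Gal(L/M)` solvable (hypothesis (a)) and irreducibility of every companion over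
`L` (hypothesis (b)), we produce a `2`-adic companion of `ρ` over `K` itself:

1. Brauer–Solomon on `Q = Gal(L/K)`: `1 = ∑ nᵢ Ind_{H̄ᵢ}^Q θᵢ` with `H̄ᵢ` solvable
   (`exists_brauerTaylor_descentData`), pulled back to `Hᵢ = π⁻¹H̄ᵢ ≤ Γ_K` (`N = Γ_L ≤ Hᵢ`);
2. `Hᵢ ≃ Γ_{Eᵢ}`, `Eᵢ = L^{H̄ᵢ}` (`exists_transport`), and the semisimplified companions `σᵢ`
   over `Eᵢ` give `rᵢ = σᵢ ∘ tᵢ` on `Hᵢ`, irreducible on `N` (`isIrreducible_comp_inclusion_of_companions`,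
   using (b) over `L`) with `rᵢ^g| ≅ rⱼ|` (`nonempty_equiv_mackeyConjRep_of_companions`);
3. virtual Brauer descent (`Representation.exists_irreducible_virtualBrauerDescent`): an
   irreducible `W` with the Hom formula and `dim W = n`;
4. `W|_{Hⱼ} ≅ rⱼ` (`nonempty_equiv_comp_subtype_of_homFormula` + the single-index pairing
   `sum_finrank_intertwiningMap_coind_comap_one_eq_one`);
5. frame `W` along `W|_{H_{i₀}} ≅ r_{i₀}` (`exists_framedRep_extending`): a continuous
   `ρ₂ : Γ_K →ₜ* GL_n(\bar ℚ₂)` with `ρ₂|_{Hᵢ}` having the charpolys of `σᵢ ∘ tᵢ`;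
6. `ρ₂` is unramified almost everywhere (`I_𝔓 ≤ N` a.e.) and at almost every `v` every Frobenius
   is conjugate into some `Hᵢ` (Brauer's identity evaluated at `Frob_v`: some `Ind θᵢ (Frob) ≠ 0`),
   where `charpoly ρ₂ = charpoly σᵢ(t ·)` matches `charpoly ρ` through one Satake parameter
   (`exists_charpoly_comp_transport_eq`); independence of the Frobenius from unramifiedness.
-/

set_option linter.dupNamespace false

noncomputable section

open Field IsDedekindDomain NumberField Polynomial Topology
open Literature.NumberTheory.GaloisRepresentations Literature.NumberTheory.Automorphic
open Literature.RepresentationTheory Literature.RepresentationTheory.FiniteGroups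
open Literature.RepresentationTheory.Semisimple
open scoped NumberField Pointwise BigOperators

namespace Summit.Langlands.Langlands.Theorems.BrauerTaylorDescent

/-- If the induced class function `Ind_H^G φ` does not vanish at `s`, then `s` is conjugate into
`H`. [folklore] -/
theorem exists_conj_mem_of_indClassFun_ne_zero {G : Type} [Group G] [Fintype G] (H : Subgroup G)
    (φ : H → ℂ) {s : G} (h : indClassFun H φ s ≠ 0) : ∃ t : G, t⁻¹ * s * t ∈ H := by
  by_contra! hcon
  apply h
  unfold indClassFun
  refine mul_eq_zero_of_right _ (Finset.sum_eq_zero fun t _ => ?_)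
  rw [Function.extend_apply' _ _ _ (fun ⟨a, ha⟩ => hcon t (ha ▸ a.2))]
  rfl

/-- A group all of whose elements are trivial is solvable (used for `Gal(L/L)`). [folklore] -/
theorem isSolvable_algEquiv_self (L : Type) [Field L] : IsSolvable (L ≃ₐ[L] L) := by
  have h1 : ∀ a : L ≃ₐ[L] L, a = 1 := fun a => AlgEquiv.ext fun x => a.commutes x
  exact isSolvable_of_comm fun a b => by rw [h1 a, h1 b]

set_option maxHeartbeats 400000 in
/-- **Brauer–Taylor descent** (`PotentialCompanionDescent.BrauerTaylorDescent`): the 2-adic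
companions over the layers `L^{H̄}`, `H̄ ≤ Gal(L/K)` solvable, glue along Brauer's induction
theorem to a continuous framed `ρ₂ : Γ_K → GL_n(\bar ℚ₂)`, unramified almost everywhere and with
the same Satake parameters as `ρ` at almost every place.
Barnet-Lamb–Gee–Geraghty–Taylor 2014, proof of Thm. 5.5.1; Taylor 2006, proof of Thm. 6.6.
[cite: BarnetlambEtAl2014, proof of Thm. 5.5.1 (arXiv:1010.2561 Thm. 5.4.1)] -/
theorem brauerTaylorDescent_proof :
    Summit.Langlands.Langlands.Theses.PotentialCompanionDescent.BrauerTaylorDescent := by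
  intro K _ _ n ℓ _ ι ι₂ ρ L _ _ _ _ hcomp hirrL
  classical
  haveI : Fintype (L ≃ₐ[K] L) := Fintype.ofFinite _
  haveI : CharZero (PadicAlgCl 2) :=
    charZero_of_injective_algebraMap (algebraMap ℚ_[2] (PadicAlgCl 2)).injective
  -- the finite quotient `π : Γ_K → Q = Gal(L/K)` (`absGaloisQuot K L`) and its kernel `N = Γ_L`
  have hπ : Function.Surjective (absGaloisQuot K L) := absGaloisQuot_surjective K L
  obtain ⟨e, -⟩ : ∃ _ : ℂ →+* PadicAlgCl 2, True := ⟨(ι₂.symm : ℂ ≃+* PadicAlgCl 2), trivial⟩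
  have hNrange : ∀ γ, γ ∈ (absGaloisRestrict K L).range ↔ γ ∈ (absGaloisQuot K L).ker := fun γ =>
    (absGaloisQuot_eq_one_iff K L γ).symm.trans MonoidHom.mem_ker.symm
  have hN : IsOpen ((absGaloisQuot K L).ker : Set (absoluteGaloisGroup K)) := by
    have : ((absGaloisQuot K L).ker : Set (absoluteGaloisGroup K)) =
        Set.range (absGaloisRestrict K L) :=
      Set.ext fun γ => (hNrange γ).symm.trans MonoidHom.mem_range
    rw [this]
    exact isOpen_range_absGaloisRestrict K L
  haveI hNfin : (absGaloisQuot K L).ker.FiniteIndex := by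
    refine ⟨?_⟩
    rw [← MonoidHom.comap_bot, Subgroup.index_comap_of_surjective _ hπ]
    exact Subgroup.FiniteIndex.index_ne_zero
  have hcL : ∀ γ, γ ∈ (absGaloisRestrict K L).range ↔
      (1 : absoluteGaloisGroup K)⁻¹ * γ * 1 ∈ (absGaloisQuot K L).ker := fun γ => by
    rw [inv_one, one_mul, mul_one]; exact hNrange γ
  obtain ⟨tL, htL⟩ := exists_transport hcL
  -- (b): the companion over `L` is irreducible
  obtain ⟨σL, hunrL, hmatchL⟩ := hcomp L (isSolvable_algEquiv_self L)
  have hirrσL : (FramedRep.toRepresentation σL).IsIrreducible := hirrL σL hunrL hmatchL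
  -- (1) Brauer–Solomon descent data on `Q`
  obtain ⟨ιB, hfin, Hb, θ, nB, hsolv, hBr, hdimB, hθ, hBB⟩ :=
    exists_brauerTaylor_descentData (absGaloisQuot K L) hπ (PadicAlgCl 2) e
  have hNH : ∀ i, (absGaloisQuot K L).ker ≤ (Hb i).comap (absGaloisQuot K L) := fun i x hx =>
    Subgroup.mem_comap.2 (by rw [MonoidHom.mem_ker.1 hx]; exact one_mem _)
  haveI hHfin : ∀ i, ((Hb i).comap (absGaloisQuot K L)).FiniteIndex := fun i =>
    ⟨by rw [Subgroup.index_comap_of_surjective _ hπ]; exact Subgroup.FiniteIndex.index_ne_zero⟩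
  -- (2) conjugators, transports `Hᵢ ≃ Γ_{Eᵢ}` and semisimple companions `σᵢ` over `Eᵢ = L^{H̄ᵢ}`
  have hci : ∀ i, ∃ c : absoluteGaloisGroup K, ∀ γ,
      γ ∈ (absGaloisRestrict K (IntermediateField.fixedField (Hb i))).range ↔
        c⁻¹ * γ * c ∈ (Hb i).comap (absGaloisQuot K L) :=
    fun i => exists_conj_range_absGaloisRestrict_fixedField_iff K L (Hb i)
  choose c hc using hci
  have hti : ∀ i, ∃ t : (Hb i).comap (absGaloisQuot K L) →ₜ*
      absoluteGaloisGroup (IntermediateField.fixedField (Hb i)),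
      ∀ h : (Hb i).comap (absGaloisQuot K L),
        absGaloisRestrict K (IntermediateField.fixedField (Hb i)) (t h) = c i * h * (c i)⁻¹ :=
    fun i => exists_transport (hc i)
  choose t ht using hti
  have hσi : ∀ i, ∃ σ : FramedGaloisRep (IntermediateField.fixedField (Hb i)) (PadicAlgCl 2) n,
      (FramedRep.toRepresentation σ).IsSemisimpleRepresentation ∧
      (∀ᶠ w : HeightOneSpectrum (𝓞 (IntermediateField.fixedField (Hb i))) in Filter.cofinite,
        σ.IsUnramifiedAt w) ∧
      (∀ᶠ w : HeightOneSpectrum (𝓞 (IntermediateField.fixedField (Hb i))) in Filter.cofinite,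
        ∃ α : Multiset ℂ,
          (ρ.restrictField (IntermediateField.fixedField (Hb i))).HasFrobCharpolyAt w
            (arithFrobPolyOfSatake ι w.residueCard 1 α) ∧
          σ.HasFrobCharpolyAt w (arithFrobPolyOfSatake ι₂ w.residueCard 1 α)) := fun i => by
    obtain ⟨ρ₂, hunr, hmatch⟩ := hcomp (IntermediateField.fixedField (Hb i))
      (isSolvable_gal_fixedField K L (Hb i) (hsolv i))
    obtain ⟨σ, hss, -, -, hunr', hfrob'⟩ := FramedGaloisRep.exists_semisimplification ρ₂
    exact ⟨σ, hss, hunr.mono fun w hw => hunr' w hw,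
      hmatch.mono fun w ⟨α, h1, h2⟩ => ⟨α, h1, hfrob' w _ h2⟩⟩
  choose σ hss hunr hmatch using hσi
  -- (2') `rᵢ = σᵢ ∘ tᵢ` is irreducible on `N` and `rᵢ^g| ≅ rⱼ|`
  have hr : ∀ i, Representation.IsIrreducible
      ((FramedRep.toRepresentation ((σ i).comp (t i))).comp (Subgroup.inclusion (hNH i))) :=
    fun i => isIrreducible_comp_inclusion_of_companions ι ι₂ ρ (t i) (ht i) (σ i) (hmatch i)
      tL htL σL hmatchL hcL (hc i) hN (hNH i) hirrσL (hss i)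
  have hiso : ∀ i j (g : absoluteGaloisGroup K), Nonempty (Representation.Equiv
      (mackeyConjRep ((Hb i).comap (absGaloisQuot K L)) ((Hb j).comap (absGaloisQuot K L))
        (FramedRep.toRepresentation ((σ i).comp (t i))) g)
      ((FramedRep.toRepresentation ((σ j).comp (t j))).comp
        (mackeySubgroup ((Hb i).comap (absGaloisQuot K L))
          ((Hb j).comap (absGaloisQuot K L)) g).subtype)) :=
    fun i j g => nonempty_equiv_mackeyConjRep_of_companions ι ι₂ ρ (t i) (ht i) (σ i) (hmatch i)
      (t j) (ht j) (σ j) (hmatch j) (absGaloisQuot K L).ker hN (hNH i) (hNH j) (hr i) (hr j) g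
  -- (3) virtual Brauer descent
  have hψ : ∀ i (x : (Hb i).comap (absGaloisQuot K L)),
      (x : absoluteGaloisGroup K) ∈ (absGaloisQuot K L).ker →
        (((Units.map (e : ℂ →* PadicAlgCl 2)).comp (θ i)).comp
          ((absGaloisQuot K L).subgroupComap (Hb i))) x = 1 :=
    fun i x hx => hθ i x (MonoidHom.mem_ker.1 hx)
  obtain ⟨i₀, W, -, -, hW, -, hWdim⟩ :=
    Representation.exists_irreducible_virtualBrauerDescent
      (fun i => (Hb i).comap (absGaloisQuot K L)) (absGaloisQuot K L).ker hNH
      (fun i => FramedRep.toRepresentation ((σ i).comp (t i)))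
      (fun i => ((Units.map (e : ℂ →* PadicAlgCl 2)).comp (θ i)).comp
        ((absGaloisQuot K L).subgroupComap (Hb i))) nB hψ hr hiso hBB hdimB
  -- (4) `W|_{Hⱼ} ≅ rⱼ`
  have hej : ∀ j, Nonempty (Representation.Equiv (FramedRep.toRepresentation ((σ j).comp (t j)))
      (W.toRepresentation.comp ((Hb j).comap (absGaloisQuot K L)).subtype)) :=
    fun j => nonempty_equiv_comp_subtype_of_homFormula (X := W.toSubmodule)
      (fun i => (Hb i).comap (absGaloisQuot K L)) (absGaloisQuot K L).ker hNH
      (fun i => FramedRep.toRepresentation ((σ i).comp (t i)))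
      (fun i => ((Units.map (e : ℂ →* PadicAlgCl 2)).comp (θ i)).comp
        ((absGaloisQuot K L).subgroupComap (Hb i))) nB hψ hr hiso
      (fun j => sum_finrank_intertwiningMap_coind_comap_one_eq_one (absGaloisQuot K L) hπ e Hb θ
        nB hBr j)
      W.toRepresentation (fun {Y} _ _ _ τ => hW τ) j hWdim
  -- (5) frame `W` along `W|_{H_{i₀}} ≅ r_{i₀}`
  obtain ⟨e₀⟩ := hej i₀
  obtain ⟨ρ₂, hρ₂res, hρ₂cp⟩ := exists_framedRep_extending (X := W.toSubmodule)
    W.toRepresentation ((Hb i₀).comap (absGaloisQuot K L))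
    (Subgroup.isOpen_mono (hNH i₀) hN) ((σ i₀).comp (t i₀)) e₀
  have hcpj : ∀ j (h : (Hb j).comap (absGaloisQuot K L)),
      FramedRep.charpoly ρ₂ (h : absoluteGaloisGroup K) =
        FramedRep.charpoly ((σ j).comp (t j)) h := fun j h => by
    obtain ⟨ej⟩ := hej j
    have hWj := charpoly_eq_of_equiv (X := W.toSubmodule) W.toRepresentation
      ((Hb j).comap (absGaloisQuot K L)) ((σ j).comp (t j)) ej h
    have hρ₂h := hρ₂cp (h : absoluteGaloisGroup K)
    -- (`simp only`, not `rw`: the two `LinearMap.charpoly` instance paths differ reducibly)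
    simp only [hρ₂h, hWj]
  -- (6) the good places: inertia inside `N`, every `σᵢ` unramified and matching above `v`
  have hgood : ∀ᶠ v : HeightOneSpectrum (𝓞 K) in Filter.cofinite,
      (∀ 𝔓 ∈ v.primesAbove,
        𝔓.inertia (absoluteGaloisGroup K) ≤ (absGaloisRestrict K L).range) ∧
      ∀ i, (∀ w : HeightOneSpectrum (𝓞 (IntermediateField.fixedField (Hb i))),
          w.asIdeal.under (𝓞 K) = v.asIdeal → (σ i).IsUnramifiedAt w) ∧
        (∀ w : HeightOneSpectrum (𝓞 (IntermediateField.fixedField (Hb i))),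
          w.asIdeal.under (𝓞 K) = v.asIdeal → ∃ α : Multiset ℂ,
            (ρ.restrictField (IntermediateField.fixedField (Hb i))).HasFrobCharpolyAt w
              (arithFrobPolyOfSatake ι w.residueCard 1 α) ∧
            (σ i).HasFrobCharpolyAt w (arithFrobPolyOfSatake ι₂ w.residueCard 1 α)) :=
    (eventually_forall_inertia_le_range_absGaloisRestrict K L).and
      (Filter.eventually_all.2 fun i =>
        (eventually_forall_under (hunr i)).and (eventually_forall_under (hmatch i)))
  refine ⟨ρ₂, hgood.mono fun v hv => ?_, hgood.mono fun v hv => ?_⟩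
  · -- `ρ₂` kills the inertia above `v`: `I_𝔓 ≤ N ≤ H_{i₀}` and `ρ₂|_{H_{i₀}} = σ_{i₀} ∘ t_{i₀}`
    intro 𝔓 h𝔓 u hu
    have huN : u ∈ (Hb i₀).comap (absGaloisQuot K L) := hNH i₀ ((hNrange u).1 (hv.1 𝔓 h𝔓 hu))
    rw [show u = ((⟨u, huN⟩ : (Hb i₀).comap (absGaloisQuot K L)) : absoluteGaloisGroup K)
      from rfl, hρ₂res]
    exact comp_transport_eq_one_of_mem_inertia (t i₀) (ht i₀) (σ i₀) (hv.2 i₀).1 h𝔓 hu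
  -- (7) matching at a good place `v`
  have hρ₂v : FramedGaloisRep.IsUnramifiedAt v ρ₂ := by
    intro 𝔓 h𝔓 u hu
    have huN : u ∈ (Hb i₀).comap (absGaloisQuot K L) := hNH i₀ ((hNrange u).1 (hv.1 𝔓 h𝔓 hu))
    rw [show u = ((⟨u, huN⟩ : (Hb i₀).comap (absGaloisQuot K L)) : absoluteGaloisGroup K)
      from rfl, hρ₂res]
    exact comp_transport_eq_one_of_mem_inertia (t i₀) (ht i₀) (σ i₀) (hv.2 i₀).1 h𝔓 hu
  have key : ∀ 𝔓 ∈ v.primesAbove, ∀ g : absoluteGaloisGroup K, IsArithFrobAt (𝓞 K) g 𝔓 →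
      ∃ α : Multiset ℂ, FramedRep.charpoly ρ g = arithFrobPolyOfSatake ι v.residueCard 1 α ∧
        FramedRep.charpoly ρ₂ g = arithFrobPolyOfSatake ι₂ v.residueCard 1 α := by
    intro 𝔓 h𝔓 g hg
    -- Brauer's identity at `π g`: some `Ind θᵢ (π g) ≠ 0`, so `g` is conjugate into `Hᵢ`
    have hsum : ∑ i, (nB i : ℂ) * indClassFun (Hb i) (fun h => ((θ i h : ℂˣ) : ℂ))
        (absGaloisQuot K L g) ≠ 0 := by
      rw [hBr]; exact one_ne_zero
    obtain ⟨i, -, hi⟩ := Finset.exists_ne_zero_of_sum_ne_zero hsum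
    obtain ⟨y, hy⟩ := exists_conj_mem_of_indClassFun_ne_zero (Hb i) _ (right_ne_zero_of_mul hi)
    obtain ⟨d, hd⟩ := exists_conj_mem_comap_of_mem_conj K L (Hb i) g y hy
    have hfrob : IsArithFrobAt (𝓞 K)
        (((⟨d⁻¹ * g * d, hd⟩ : (Hb i).comap (absGaloisQuot K L)) : absoluteGaloisGroup K))
        (d⁻¹ • 𝔓) := by
      have := hg.conj d⁻¹
      rwa [inv_inv] at this
    obtain ⟨α, h1, h2⟩ := exists_charpoly_comp_transport_eq ι ι₂ ρ (t i) (ht i) (σ i) (hv.2 i).2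
      (smul_mem_primesAbove h𝔓 d⁻¹) hfrob
    have hc1 : FramedRep.charpoly ρ (d⁻¹ * g * d) = FramedRep.charpoly ρ g := by
      have := charpoly_conj ρ d⁻¹ g
      rwa [inv_inv] at this
    have hc2 : FramedRep.charpoly ρ₂ (d⁻¹ * g * d) = FramedRep.charpoly ρ₂ g := by
      have := charpoly_conj ρ₂ d⁻¹ g
      rwa [inv_inv] at this
    refine ⟨α, ?_, ?_⟩
    · rw [← hc1]; exact h1
    · rw [← hc2, ← h2]; exact hcpj i ⟨d⁻¹ * g * d, hd⟩
  -- one Frobenius fixes the Satake parameter; `ρ₂` (unramified at `v`) is constant on Frobenii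
  obtain ⟨𝔓₀, h𝔓₀⟩ := v.primesAbove_nonempty
  obtain ⟨g₀, hg₀⟩ := HeightOneSpectrum.exists_isArithFrobAt_of_mem_primesAbove_holds h𝔓₀
  obtain ⟨α₀, hα₁, hα₂⟩ := key 𝔓₀ h𝔓₀ g₀ hg₀
  have hconst : ∀ 𝔓 ∈ v.primesAbove, ∀ g : absoluteGaloisGroup K, IsArithFrobAt (𝓞 K) g 𝔓 →
      FramedRep.charpoly ρ₂ g = FramedRep.charpoly ρ₂ g₀ := by
    intro 𝔓 h𝔓 g hg
    obtain ⟨s, rfl⟩ := HeightOneSpectrum.exists_smul_eq_of_mem_primesAbove_holds h𝔓₀ h𝔓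
    have hg' : IsArithFrobAt (𝓞 K) (s * g₀ * s⁻¹) (s • 𝔓₀) := hg₀.conj s
    have h1 : ρ₂ (g * (s * g₀ * s⁻¹)⁻¹) = 1 :=
      hρ₂v (s • 𝔓₀) h𝔓 _ (hg.mul_inv_mem_inertia hg')
    have h2 : ρ₂ g = ρ₂ (s * g₀ * s⁻¹) := by
      conv_lhs => rw [← inv_mul_cancel_right g (s * g₀ * s⁻¹), map_mul, h1, one_mul]
    rw [← charpoly_conj ρ₂ s g₀, FramedRep.charpoly, FramedRep.charpoly, h2]
  refine ⟨α₀, fun 𝔓 h𝔓 g hg => ?_, fun 𝔓 h𝔓 g hg => ?_⟩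
  · obtain ⟨α, h1, h2⟩ := key 𝔓 h𝔓 g hg
    have hαeq : α = α₀ :=
      arithFrobPolyOfSatake_injective ι₂ (Nat.zero_lt_of_lt v.one_lt_residueCard) 1
        (h2.symm.trans ((hconst 𝔓 h𝔓 g hg).trans hα₂))
    rw [h1, hαeq]
  · rw [hconst 𝔓 h𝔓 g hg, hα₂]

end Summit.Langlands.Langlands.Theorems.BrauerTaylorDescent

end
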